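import Summits.RiemannHypothesis.RiemannHypothesis.Theorems.GroundBartaEvenWinsBeyondArchDeflationWindowGlue
import HarnessLib

/-!
# RiemannHypothesis / GroundBarta — rung 4 (`EvenWinsBeyondArch`, stmt-RiemannHypothesis-18807 / 18085):
# the deflated Temple L-side — cross terms `∫ r_i r̄_k` of the residual Gram matrix from panel bounds

Helper file (`--supports stmt-RiemannHypothesis-18807`), RH-free, no facts.  Prover B, speedrun unit `sr-gb-rung-b` (gen 4).
Prover A's full-Gram criterion (`dt_psd_of_crossGram`) needs, besides `s_i ≥ ∫‖r_i‖²` (files `…SigmaPanels`, `…WindowGlue`),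
two-sided bounds on the off-diagonal entries `(∫ r_i r̄_k).re`, `r_i = F_i − Σ_l W_il v_l`.  As for the diagonal:
`r_i r̄_k` is integrable (polarisation of two `L²` functions), supported in the window, even (both residuals have parity `σ`), so
`(∫ r_i r̄_k).re = 2 Σ_{j<m} ∫_{-h}^{h} R_i(y_j+ρ) R_k(y_j+ρ) dρ` with the explicit real residuals `R` of `…WindowGlue`; per-panel
two-sided bounds add up (`dt_residual_cross_mem_of_panelBounds`).  Also the square-root-free Cauchy–Schwarz surrogate
`|∫ f g| ≤ (t ∫f² + ∫g²/t)/2` used on the edge panel.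
-/

set_option linter.dupNamespace false

noncomputable section

open MeasureTheory Set Filter intervalIntegral
open scoped Topology BigOperators ComplexConjugate

namespace Summit.RiemannHypothesis.RiemannHypothesis.Theorems.EvenWinsBeyondArch

open Literature.NumberTheory.LFunctions
open Literature.Analysis.ValidatedNumerics Literature.Analysis.ValidatedNumerics.PolyMP
  Literature.Analysis.ValidatedNumerics.NumericsMP Literature.Analysis.ValidatedNumerics.ExpPoly

section AMGM

/-- One-sided AM–GM bound `∫ f g ≤ (t ∫f² + ∫g²/t)/2`. -/
theorem dt_integral_mul_le_amgm {h : ℝ} (hh : 0 ≤ h) {f g : ℝ → ℝ} {qf qg t : ℝ} (ht : 0 < t)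
    (hf2 : IntervalIntegrable (fun ρ => f ρ ^ 2) volume (-h) h) (hg2 : IntervalIntegrable (fun ρ => g ρ ^ 2) volume (-h) h)
    (hfg : IntervalIntegrable (fun ρ => f ρ * g ρ) volume (-h) h)
    (hqf : ∫ ρ in (-h)..h, f ρ ^ 2 ≤ qf) (hqg : ∫ ρ in (-h)..h, g ρ ^ 2 ≤ qg) :
    ∫ ρ in (-h)..h, f ρ * g ρ ≤ (t * qf + qg / t) / 2 := by
  have hle : -h ≤ h := by linarith
  have hpt : ∀ ρ ∈ Icc (-h) h, f ρ * g ρ ≤ (t * f ρ ^ 2 + g ρ ^ 2 / t) / 2 := by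
    intro ρ _
    have : 0 ≤ (t * f ρ - g ρ) ^ 2 / t := by positivity
    have e : (t * f ρ - g ρ) ^ 2 / t = t * f ρ ^ 2 + g ρ ^ 2 / t - 2 * (f ρ * g ρ) := by
      field_simp; ring
    linarith
  have h1 := intervalIntegral.integral_mono_on hle hfg
    (((hf2.const_mul t).add (hg2.div_const t)).div_const 2) hpt
  have h2 : ∫ ρ in (-h)..h, (t * f ρ ^ 2 + g ρ ^ 2 / t) / 2 =
      (t * (∫ ρ in (-h)..h, f ρ ^ 2) + (∫ ρ in (-h)..h, g ρ ^ 2) / t) / 2 := by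
    rw [intervalIntegral.integral_div, intervalIntegral.integral_add (hf2.const_mul t) (hg2.div_const t),
      intervalIntegral.integral_const_mul, intervalIntegral.integral_div]
  rw [h2] at h1
  have h3 : t * (∫ ρ in (-h)..h, f ρ ^ 2) ≤ t * qf := mul_le_mul_of_nonneg_left hqf ht.le
  have h4 : (∫ ρ in (-h)..h, g ρ ^ 2) / t ≤ qg / t := div_le_div_of_nonneg_right hqg ht.le
  linarith

/-- **Cauchy–Schwarz surrogate without square roots**: if `∫ f² ≤ qf`, `∫ g² ≤ qg` on `[-h, h]` and `t > 0`, then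
`|∫ f g| ≤ (t·qf + qg/t)/2` (take `t ≈ √(qg/qf)`). -/
theorem dt_integral_mul_abs_le_amgm {h : ℝ} (hh : 0 ≤ h) {f g : ℝ → ℝ} {qf qg t : ℝ} (ht : 0 < t)
    (hf2 : IntervalIntegrable (fun ρ => f ρ ^ 2) volume (-h) h) (hg2 : IntervalIntegrable (fun ρ => g ρ ^ 2) volume (-h) h)
    (hfg : IntervalIntegrable (fun ρ => f ρ * g ρ) volume (-h) h)
    (hqf : ∫ ρ in (-h)..h, f ρ ^ 2 ≤ qf) (hqg : ∫ ρ in (-h)..h, g ρ ^ 2 ≤ qg) :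
    |∫ ρ in (-h)..h, f ρ * g ρ| ≤ (t * qf + qg / t) / 2 := by
  have hup := dt_integral_mul_le_amgm hh ht hf2 hg2 hfg hqf hqg
  have hf2' : IntervalIntegrable (fun ρ => (-f ρ) ^ 2) volume (-h) h := by simpa using hf2
  have hfg' : IntervalIntegrable (fun ρ => (-f ρ) * g ρ) volume (-h) h := by
    have h1 : IntervalIntegrable (fun ρ => -(f ρ * g ρ)) volume (-h) h := hfg.neg
    exact (intervalIntegrable_congr fun ρ _ => by simp only [neg_mul]).1 h1
  have hqf' : ∫ ρ in (-h)..h, (-f ρ) ^ 2 ≤ qf := by simpa using hqf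
  have hlo := dt_integral_mul_le_amgm hh ht hf2' hg2 hfg' hqf' hqg
  have e : ∫ ρ in (-h)..h, (-f ρ) * g ρ = -∫ ρ in (-h)..h, f ρ * g ρ := by
    rw [← intervalIntegral.integral_neg]; exact intervalIntegral.integral_congr fun ρ _ => by ring
  rw [e] at hlo
  exact abs_le.2 ⟨by linarith, hup⟩

end AMGM

section Cross

variable {c : ℝ}

/-- `∫ f = 2 ∫_0^c f` for an integrable even real function supported in `[-c, c]`. -/
theorem dt_integral_even_eq_two_mul {f : ℝ → ℝ} (hc : 0 < c) (hfi : Integrable f)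
    (hf0 : ∀ y, y ∉ Icc (-c) c → f y = 0) (hfn : ∀ y, f (-y) = f y) :
    ∫ y, f y = 2 * ∫ y in (0 : ℝ)..c, f y := by
  have h1 : ∫ y, f y = ∫ y in Icc (-c) c, f y :=
    (setIntegral_eq_integral_of_forall_compl_eq_zero fun y hy ↦ hf0 y hy).symm
  have hii : ∀ a b : ℝ, IntervalIntegrable f volume a b := fun a b ↦ hfi.intervalIntegrable
  rw [h1, integral_Icc_eq_integral_Ioc, ← intervalIntegral.integral_of_le (by linarith),
    ← intervalIntegral.integral_add_adjacent_intervals (hii (-c) 0) (hii 0 c)]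
  have h2 : ∫ y in (-c)..0, f y = ∫ y in (0 : ℝ)..c, f y := by
    have h := intervalIntegral.integral_comp_neg (f := f) (a := 0) (b := c)
    simp only [neg_zero, hfn] at h
    exact h.symm
  rw [h2]
  ring

/-- Polarisation: `(a b̄).re = (‖a + b‖² − ‖a‖² − ‖b‖²)/2`. -/
theorem dt_re_mul_conj_eq (a b : ℂ) : (a * conj b).re = (‖a + b‖ ^ 2 - ‖a‖ ^ 2 - ‖b‖ ^ 2) / 2 := by
  have h := Complex.normSq_add a b
  rw [Complex.normSq_eq_norm_sq, Complex.normSq_eq_norm_sq, Complex.normSq_eq_norm_sq] at h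
  linarith

variable {k : ℕ}

/-- **The cross-term assembly.**  Two residuals `r_i = F_i − Σ W_il v_l`, `r_k` of a parity-`σ` family (`C²` profiles,
windowed vectors, explicit window images), real functions `Ri`, `Rk` agreeing with them on `[0, c)`, and per-panel
two-sided bounds `lo_j ≤ ∫_{-h}^{h} Ri(y_j+ρ) Rk(y_j+ρ) dρ ≤ hi_j` (`h = c/(2m)`, `y_j = (2j+1)h`) give
`2 Σ lo_j ≤ (∫ r_i r̄_k).re ≤ 2 Σ hi_j`. [cite: GoerischHaunhorst1985, §2] -/
theorem dt_residual_cross_mem_of_panels (hc : 0 < c) {σ : ℝ} (hσ : σ = 1 ∨ σ = -1)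
    (g : Fin k → ℝ → ℝ) (hg : ∀ i, ContDiff ℝ 2 (g i)) (hgp : ∀ i x, g i (-x) = σ * g i x)
    (v F : Fin k → ℝ → ℂ) (hv : ∀ i x, v i x = (((Icc (-c) c).indicator (g i) x : ℝ) : ℂ))
    (hF : ∀ i y, F i y = (Icc (-c) c).indicator (fun y ↦
        2 * (∫ x, v i x * (Real.cosh (x / 2) : ℂ)) * (Real.cosh (y / 2) : ℂ) -
          2 * (∫ x, v i x * (Real.sinh (x / 2) : ℂ)) * (Real.sinh (y / 2) : ℂ) +
        (∑ n ∈ weilPrimeIndex c, (((ArithmeticFunction.vonMangoldt n : ℝ) / Real.sqrt n : ℝ) : ℂ) *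
          (2 * v i y - v i (y - Real.log n) - v i (y + Real.log n))) +
        ∫ t in Ioi 0, (weilArchDensity t : ℂ) * (2 * v i y - v i (y - t) - v i (y + t))) y -
      (weilMarkovConstant c : ℂ) * v i y)
    (W : Fin k → Fin k → ℝ) (i i' : Fin k) {m : ℕ} (hm : 0 < m) (Ri Rk : ℝ → ℝ)
    (hRi : ∀ y ∈ Ico 0 c, (F i - ∑ l, W i l • v l) y = (Ri y : ℂ))
    (hRk : ∀ y ∈ Ico 0 c, (F i' - ∑ l, W i' l • v l) y = (Rk y : ℂ)) (lo hi : ℕ → ℝ)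
    (hlo : ∀ j, j < m → lo j ≤ ∫ ρ in (-(c / (2 * m)))..(c / (2 * m)),
      Ri ((2 * j + 1) * (c / (2 * m)) + ρ) * Rk ((2 * j + 1) * (c / (2 * m)) + ρ))
    (hhi : ∀ j, j < m → ∫ ρ in (-(c / (2 * m)))..(c / (2 * m)),
      Ri ((2 * j + 1) * (c / (2 * m)) + ρ) * Rk ((2 * j + 1) * (c / (2 * m)) + ρ) ≤ hi j) :
    2 * ∑ j ∈ Finset.range m, lo j ≤ (∫ y, (F i - ∑ l, W i l • v l) y * conj ((F i' - ∑ l, W i' l • v l) y)).re ∧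
      (∫ y, (F i - ∑ l, W i l • v l) y * conj ((F i' - ∑ l, W i' l • v l) y)).re ≤ 2 * ∑ j ∈ Finset.range m, hi j := by
  set ri : ℝ → ℂ := F i - ∑ l, W i l • v l with hri
  set rk : ℝ → ℂ := F i' - ∑ l, W i' l • v l with hrk
  set h : ℝ := c / (2 * m) with hh
  have hmr : (0 : ℝ) < m := by exact_mod_cast hm
  have hh0 : 0 < h := by rw [hh]; positivity
  have hch : c = 2 * m * h := by rw [hh]; field_simp
  -- integrability of the real cross density by polarisation
  have hmi : MemLp ri 2 := dt_residual_memLp hc g hg v F hv hF W i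
  have hmk : MemLp rk 2 := dt_residual_memLp hc g hg v F hv hF W i'
  have hms : MemLp (ri + rk) 2 := hmi.add hmk
  have hIi : Integrable fun y ↦ ‖ri y‖ ^ 2 := (memLp_two_iff_integrable_sq_norm hmi.1).1 hmi
  have hIk : Integrable fun y ↦ ‖rk y‖ ^ 2 := (memLp_two_iff_integrable_sq_norm hmk.1).1 hmk
  have hIs : Integrable fun y ↦ ‖(ri + rk) y‖ ^ 2 := (memLp_two_iff_integrable_sq_norm hms.1).1 hms
  set f : ℝ → ℝ := fun y ↦ (ri y * conj (rk y)).re with hf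
  have hfeq : f = fun y ↦ (‖(ri + rk) y‖ ^ 2 - ‖ri y‖ ^ 2 - ‖rk y‖ ^ 2) / 2 := by
    funext y; rw [hf]; simp only [Pi.add_apply]; exact dt_re_mul_conj_eq _ _
  have hfi : Integrable f := by rw [hfeq]; exact ((hIs.sub hIi).sub hIk).div_const 2
  -- support and parity
  have hf0 : ∀ y, y ∉ Icc (-c) c → f y = 0 := fun y hy ↦ by
    simp only [hf, hri, dt_residual_zero_off hv hF i hy, zero_mul, Complex.zero_re]
  have hfn : ∀ y, f (-y) = f y := fun y ↦ by
    simp only [hf, hri, hrk, dt_residual_reflect hgp hv hF i y, dt_residual_reflect hgp hv hF i' y, map_mul,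
      Complex.conj_ofReal]
    have e : (σ : ℂ) * (F i - ∑ l, W i l • v l) y * ((σ : ℂ) * conj ((F i' - ∑ l, W i' l • v l) y)) =
        ((σ : ℂ) * σ) * ((F i - ∑ l, W i l • v l) y * conj ((F i' - ∑ l, W i' l • v l) y)) := by ring
    have hs : (σ : ℂ) * σ = 1 := by rcases hσ with h1 | h1 <;> simp [h1]
    rw [e, hs, one_mul]
  have hfy : ∀ y ∈ Ico 0 c, f y = Ri y * Rk y := fun y hy ↦ by
    simp only [hf]
    rw [hRi y hy, hRk y hy, Complex.conj_ofReal, ← Complex.ofReal_mul, Complex.ofReal_re]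
  -- the integral of the real part is the real part of the integral
  have hint : Integrable fun y ↦ ri y * conj (rk y) := by
    refine Integrable.mono' ((hIi.add hIk).div_const 2)
      (hmi.1.mul (Complex.continuous_conj.comp_aestronglyMeasurable hmk.1)) ?_
    refine Filter.Eventually.of_forall fun y ↦ ?_
    change ‖ri y * conj (rk y)‖ ≤ (‖ri y‖ ^ 2 + ‖rk y‖ ^ 2) / 2
    rw [norm_mul, Complex.norm_conj]
    nlinarith [sq_nonneg (‖ri y‖ - ‖rk y‖)]
  have hre : (∫ y, ri y * conj (rk y)).re = ∫ y, f y := by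
    have h1 := integral_re hint
    simp only [RCLike.re_to_complex] at h1
    rw [hf]; exact h1.symm
  rw [hre, dt_integral_even_eq_two_mul hc hfi hf0 hfn, hch,
    intervalIntegral_eq_sum_panels f hh0.le (fun a b _ _ ↦ hfi.intervalIntegrable) m]
  -- on panel `j`, `f(y_j + ρ) = Ri Rk (y_j + ρ)` for a.e. `ρ`
  have hpanel : ∀ j ∈ Finset.range m, ∫ ρ in (-h)..h, f ((2 * j + 1) * h + ρ) =
      ∫ ρ in (-h)..h, Ri ((2 * j + 1) * h + ρ) * Rk ((2 * j + 1) * h + ρ) := by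
    intro j hj
    have hjm : j < m := Finset.mem_range.1 hj
    refine intervalIntegral.integral_congr_ae ?_
    have hne : ∀ᵐ ρ : ℝ ∂volume, ρ ≠ h := by rw [ae_iff]; simp
    filter_upwards [hne] with ρ hρne hρ
    rw [uIoc_of_le (by linarith)] at hρ
    have hρlt : ρ < h := lt_of_le_of_ne hρ.2 hρne
    have hj0 : (0 : ℝ) ≤ j := by exact_mod_cast Nat.zero_le j
    have hj1 : (j : ℝ) + 1 ≤ m := by exact_mod_cast hjm
    refine hfy _ ⟨?_, ?_⟩
    · nlinarith [hρ.1]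
    · rw [hch]; nlinarith
  rw [Finset.sum_congr rfl hpanel]
  constructor
  · have := Finset.sum_le_sum fun j hj ↦ hlo j (Finset.mem_range.1 hj)
    linarith
  · have := Finset.sum_le_sum fun j hj ↦ hhi j (Finset.mem_range.1 hj)
    linarith

/-- **Integrability side condition** for the cross terms: `ρ ↦ Ri(y_j+ρ)·Rk(y_j+ρ)` is interval integrable on every panel. -/
theorem dt_residual_mul_intervalIntegrable (hc : 0 < c)
    (g : Fin k → ℝ → ℝ) (hg : ∀ i, ContDiff ℝ 2 (g i))
    (v F : Fin k → ℝ → ℂ) (hv : ∀ i x, v i x = (((Icc (-c) c).indicator (g i) x : ℝ) : ℂ))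
    (hF : ∀ i y, F i y = (Icc (-c) c).indicator (fun y ↦
        2 * (∫ x, v i x * (Real.cosh (x / 2) : ℂ)) * (Real.cosh (y / 2) : ℂ) -
          2 * (∫ x, v i x * (Real.sinh (x / 2) : ℂ)) * (Real.sinh (y / 2) : ℂ) +
        (∑ n ∈ weilPrimeIndex c, (((ArithmeticFunction.vonMangoldt n : ℝ) / Real.sqrt n : ℝ) : ℂ) *
          (2 * v i y - v i (y - Real.log n) - v i (y + Real.log n))) +
        ∫ t in Ioi 0, (weilArchDensity t : ℂ) * (2 * v i y - v i (y - t) - v i (y + t))) y -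
      (weilMarkovConstant c : ℂ) * v i y)
    (W : Fin k → Fin k → ℝ) (i i' : Fin k) {m : ℕ} (hm : 0 < m) (Ri Rk : ℝ → ℝ)
    (hRi : ∀ y ∈ Ico 0 c, (F i - ∑ l, W i l • v l) y = (Ri y : ℂ))
    (hRk : ∀ y ∈ Ico 0 c, (F i' - ∑ l, W i' l • v l) y = (Rk y : ℂ)) {j : ℕ} (hjm : j < m) :
    IntervalIntegrable (fun ρ ↦ Ri ((2 * j + 1) * (c / (2 * m)) + ρ) * Rk ((2 * j + 1) * (c / (2 * m)) + ρ)) volume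
      (-(c / (2 * m))) (c / (2 * m)) := by
  set ri : ℝ → ℂ := F i - ∑ l, W i l • v l with hri
  set rk : ℝ → ℂ := F i' - ∑ l, W i' l • v l with hrk
  set h : ℝ := c / (2 * m) with hh
  have hmr : (0 : ℝ) < m := by exact_mod_cast hm
  have hh0 : 0 < h := by rw [hh]; positivity
  have hch : c = 2 * m * h := by rw [hh]; field_simp
  have hmi : MemLp ri 2 := dt_residual_memLp hc g hg v F hv hF W i
  have hmk : MemLp rk 2 := dt_residual_memLp hc g hg v F hv hF W i'
  have hms : MemLp (ri + rk) 2 := hmi.add hmk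
  have hIi : Integrable fun y ↦ ‖ri y‖ ^ 2 := (memLp_two_iff_integrable_sq_norm hmi.1).1 hmi
  have hIk : Integrable fun y ↦ ‖rk y‖ ^ 2 := (memLp_two_iff_integrable_sq_norm hmk.1).1 hmk
  have hIs : Integrable fun y ↦ ‖(ri + rk) y‖ ^ 2 := (memLp_two_iff_integrable_sq_norm hms.1).1 hms
  set f : ℝ → ℝ := fun y ↦ (ri y * conj (rk y)).re with hf
  have hfeq : f = fun y ↦ (‖(ri + rk) y‖ ^ 2 - ‖ri y‖ ^ 2 - ‖rk y‖ ^ 2) / 2 := by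
    funext y; rw [hf]; simp only [Pi.add_apply]; exact dt_re_mul_conj_eq _ _
  have hfi : Integrable f := by rw [hfeq]; exact ((hIs.sub hIi).sub hIk).div_const 2
  have hI : IntegrableOn (fun ρ ↦ f ((2 * j + 1) * h + ρ)) (Ioc (-h) h) :=
    (hfi.comp_add_left ((2 * j + 1) * h)).integrableOn
  have hne : ∀ᵐ ρ : ℝ ∂volume, ρ ≠ h := by rw [ae_iff]; simp
  have hae : (fun ρ ↦ f ((2 * j + 1) * h + ρ)) =ᵐ[volume.restrict (Ioc (-h) h)]
      fun ρ ↦ Ri ((2 * j + 1) * h + ρ) * Rk ((2 * j + 1) * h + ρ) := by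
    rw [EventuallyEq, ae_restrict_iff' measurableSet_Ioc]
    filter_upwards [hne] with ρ hρne hρ
    have hρlt : ρ < h := lt_of_le_of_ne hρ.2 hρne
    have hj0 : (0 : ℝ) ≤ j := by exact_mod_cast Nat.zero_le j
    have hj1 : (j : ℝ) + 1 ≤ m := by exact_mod_cast hjm
    have hfy : ∀ y ∈ Ico 0 c, f y = Ri y * Rk y := fun y hy ↦ by
      simp only [hf]
      rw [hRi y hy, hRk y hy, Complex.conj_ofReal, ← Complex.ofReal_mul, Complex.ofReal_re]
    refine hfy _ ⟨?_, ?_⟩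
    · nlinarith [hρ.1]
    · rw [hch]; nlinarith
  exact (intervalIntegrable_iff_integrableOn_Ioc_of_le (by linarith)).2 (hI.congr_fun_ae hae)

end Cross

end Summit.RiemannHypothesis.RiemannHypothesis.Theorems.EvenWinsBeyondArch

end
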